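import Summits.CriticalPhenomena.PercolationContinuityZ3.Theorems.PercNearOneGluingNoHeavyLowerTailSunflowerChainCertificateSound
import HarnessLib
import HarnessLib.Audit

/-!
# `NoHeavyLowerTail` (crux stmt-CriticalPhenomena-4575), chain certificates — FINITE VERIFICATION V: block symmetry of the generic pattern and
# the reduction of `ThreeBlockMedianCertificate` to `checkAll = true` / chunked compiled checks

Support file (seat `prim-ineq-prove-1` gen 33; `--supports stmt-CriticalPhenomena-4575`); part of the kernel replay of
`ChainCert.ThreeBlockMedianCertificate` (files …ChainCertificate ⟵ …Structure ⟵ …Duality ⟵ …Local ⟵ …Enumeration ⟵ …Checker ⟵ …Reps ⟵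
…Sound ⟵ …Final ⟵ compiled-check files ⟵ …Holds).  No `sorry`, no named facts, nothing asserted about the crux.  The whole chain elaborates as
ONE file (HOME/code-g33/lean/File6dev.lean, rc 0); these tree files are consecutive verbatim slices of it.  Memo:
run/shared/lean/prim/prim-ineq-prove-1/FINDING-CHAINCERT-prove1-g33.md §4–§7.

CONTENTS.  `LocalDatum.bperm` (block-permuted datum), `FlocT_bperm` (orbit sum invariant), `patPre_bgen`, `medIdx_comp/joinIdx_comp/update_comp_perm`,
`valid_bperm` (validity invariant for the generic pattern), `cellsList_bperm`, `exists_canon` (minimal `cellKey` in the `S₃`-orbit), `canon_rep`;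
`flocT_nonneg_of_checkPatternFrom` (canonical valid datum, any cell prefix), **`flocT_nonneg_of_chunks`** (prefix length `L`; chunks
`checkPatternFrom b pre`, `pre ∈ enumSeq (choicesCell (cmpTabs (leTab b))) L`, may live in separate files), `flocT_nonneg_of_checkPattern`,
`threeBlockMedianCertificate_of_chunked`, `mem_allPatterns`, **`threeBlockMedianCertificate_of_checkAll`**.
MEASURED (this session, farm interpreter): `checkPattern bgen` TRUE in ≈ 220 s, prefix `[0,0]` ≈ 210 s of it; the 63 other patterns ≈ 185 s together.
-/

namespace Summit.CriticalPhenomena.PercolationContinuityZ3.Theorems.SunflowerPartition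

namespace ChainCert

open Finset

section FiniteCheck

variable {n : Fin 3 → ℕ}

/-! #### Block symmetry of the generic pattern -/

/-- Block-permuted local datum: index vectors are pre-composed with `π`. [this work] -/
def LocalDatum.bperm (D : LocalDatum) (π : Equiv.Perm (Fin 3)) : LocalDatum where
  Z j := D.Z (j ∘ π)
  O j := D.O (j ∘ π)
  E j j' := D.E (j ∘ π) (j' ∘ π)
  M j j' := D.M (j ∘ π) (j' ∘ π)

/-- Cell codes of the block-permuted datum. [this work] -/
theorem cell_bperm (D : LocalDatum) (π : Equiv.Perm (Fin 3)) (j : J) : (D.bperm π).cell j = D.cell (j ∘ π) := rfl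

/-- The abstract orbit sum is invariant under block permutations. [this work] -/
theorem FlocT_bperm (D : LocalDatum) (π : Equiv.Perm (Fin 3)) : (D.bperm π).FlocT = D.FlocT := by
  unfold LocalDatum.FlocT
  have hk : ∀ g : Sym 3, (D.bperm π).kT (gidx g 0) (gidx g 1) (gidx g 2) =
      D.kT (gidx (g ∘ π) 0) (gidx (g ∘ π) 1) (gidx (g ∘ π) 2) := by
    intro g; rfl
  simp only [hk]
  let eqv : Sym 3 ≃ Sym 3 := ⟨fun g => g ∘ π, fun g => g ∘ π.symm, fun g => by funext x; simp, fun g => by funext x; simp⟩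
  exact Fintype.sum_equiv eqv _ (fun g => D.kT (gidx g 0) (gidx g 1) (gidx g 2)) (fun g => rfl)

/-- Composition of block permutations. [this work] -/
theorem bperm_bperm (D : LocalDatum) (σ π : Equiv.Perm (Fin 3)) : (D.bperm σ).bperm π = D.bperm (π * σ) := by
  cases D; simp only [LocalDatum.bperm, LocalDatum.mk.injEq]
  refine ⟨?_, ?_, ?_, ?_⟩ <;> rfl

/-- The generic pattern compares slots identically in every block. [this work] -/
theorem patPre_bgen (e e' : Fin 3) : patPre bgen e = patPre bgen e' := by
  funext i i'
  fin_cases e <;> fin_cases e' <;> rfl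

/-- Median index vectors commute with block permutations (generic pattern). [this work] -/
theorem medIdx_comp (π : Equiv.Perm (Fin 3)) (j₁ j₂ j₃ : J) :
    medIdx (patPre bgen) (j₁ ∘ π) (j₂ ∘ π) (j₃ ∘ π) = (medIdx (patPre bgen) j₁ j₂ j₃) ∘ π := by
  funext e; simp only [medIdx, Function.comp_apply, patPre_bgen e (π e)]

/-- Maximum index vectors commute with block permutations (generic pattern). [this work] -/
theorem joinIdx_comp (π : Equiv.Perm (Fin 3)) (j₁ j₂ j₃ : J) :
    joinIdx (patPre bgen) (j₁ ∘ π) (j₂ ∘ π) (j₃ ∘ π) = (joinIdx (patPre bgen) j₁ j₂ j₃) ∘ π := by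
  funext e; simp only [joinIdx, Function.comp_apply, patPre_bgen e (π e)]

/-- Updates commute with block permutations. [this work] -/
theorem update_comp_perm (j : J) (π : Equiv.Perm (Fin 3)) (e : Fin 3) (v : Fin 3) :
    (Function.update j e v) ∘ π = Function.update (j ∘ π) (π.symm e) v := by
  funext e'
  by_cases h : e' = π.symm e
  · subst h; simp
  · have h' : π e' ≠ e := fun hh => h (by rw [← hh]; simp)
    simp [Function.update_of_ne h, Function.update_of_ne h']

/-- **Validity is invariant under block permutations** (generic pattern). [this work] -/
theorem valid_bperm {D : LocalDatum} (hv : D.Valid (patPre bgen)) (π : Equiv.Perm (Fin 3)) : (D.bperm π).Valid (patPre bgen) where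
  total := hv.total
  trans := hv.trans
  Z_O j := hv.Z_O (j ∘ π)
  E_refl j := hv.E_refl (j ∘ π)
  E_symm j j' h := hv.E_symm _ _ h
  E_trans j j' j'' h1 h2 := hv.E_trans _ _ _ h1 h2
  E_Z j j' h := hv.E_Z _ _ h
  E_O j j' h := hv.E_O _ _ h
  mono j j' h := hv.mono (j ∘ π) (j' ∘ π) fun e => by rw [patPre_bgen e (π e)]; exact h (π e)
  M_congr j j' h j'' := hv.M_congr (j ∘ π) (j' ∘ π) (fun e => by rw [patPre_bgen e (π e)]; exact h (π e)) (j'' ∘ π)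
  M_Z j j' h := hv.M_Z _ _ h
  M_O j j' h := hv.M_O _ _ h
  M_lt j j' h e := by
    have := hv.M_lt (j ∘ π) (j' ∘ π) h (π.symm e)
    rw [patPre_bgen (π.symm e) e] at this
    simpa using this
  M_lift1 j j' h e := by
    show D.Z ((Function.update j e (j' e)) ∘ π) = false
    rw [update_comp_perm]
    have := hv.M_lift1 (j ∘ π) (j' ∘ π) h (π.symm e)
    simpa using this
  M_lift1_ne j j' h e e' hne h1 h2 := by
    show D.E ((Function.update j e (j' e)) ∘ π) ((Function.update j e' (j' e')) ∘ π) = false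
    rw [update_comp_perm, update_comp_perm]
    have h1' : D.O (Function.update (j ∘ π) (π.symm e) ((j' ∘ π) (π.symm e))) = false := by
      have : D.O ((Function.update j e (j' e)) ∘ π) = false := h1
      rw [update_comp_perm] at this; simpa using this
    have h2' : D.O (Function.update (j ∘ π) (π.symm e') ((j' ∘ π) (π.symm e'))) = false := by
      have : D.O ((Function.update j e' (j' e')) ∘ π) = false := h2
      rw [update_comp_perm] at this; simpa using this
    have := hv.M_lift1_ne (j ∘ π) (j' ∘ π) h (π.symm e) (π.symm e') (fun hh => hne (π.symm.injective hh)) h1' h2'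
    simpa using this
  M_lift2 j j' h e := by
    show D.O ((Function.update j' e (j e)) ∘ π) = true
    rw [update_comp_perm]
    have := hv.M_lift2 (j ∘ π) (j' ∘ π) h (π.symm e)
    simpa using this
  M_loc j₁ j₂ j₃ hz1 ho1 hz2 ho2 hz3 ho3 h12 h13 h23 hzm := by
    show D.M ((medIdx (patPre bgen) j₁ j₂ j₃) ∘ π) ((joinIdx (patPre bgen) j₁ j₂ j₃) ∘ π) = true
    rw [← medIdx_comp, ← joinIdx_comp]
    have hzm' : D.Z (medIdx (patPre bgen) (j₁ ∘ π) (j₂ ∘ π) (j₃ ∘ π)) = true := by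
      rw [medIdx_comp]; exact hzm
    exact hv.M_loc _ _ _ hz1 ho1 hz2 ho2 hz3 ho3 h12 h13 h23 hzm'

/-- The cell list of the block-permuted datum is the permuted cell list. [this work] -/
theorem cellsList_bperm (D : LocalDatum) (π : Equiv.Perm (Fin 3)) : cellsList (D.bperm π) = permuteCells π (cellsList D) := by
  unfold permuteCells
  apply List.ext_getElem (by simp [cellsList])
  intro k h1 h2
  have hk : k < 27 := by simpa [cellsList] using h1
  simp only [cellsList, List.getElem_ofFn, cell_bperm]
  have := cellsList_getD D (encN_lt ((decN k) ∘ π))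
  rw [decN_encN] at this
  rw [← this, cellsList]

/-- **Every datum has a canonical block-permuted copy** (minimal key in its `S₃`-orbit). [this work] -/
theorem exists_canon (D : LocalDatum) :
    ∃ π : Equiv.Perm (Fin 3), isCanon bgen (cellsList (D.bperm π)) = true := by
  obtain ⟨π, -, hπ⟩ := Finset.exists_min_image Finset.univ (fun π : Equiv.Perm (Fin 3) => cellKey (cellsList (D.bperm π)))
    Finset.univ_nonempty
  refine ⟨π, ?_⟩
  unfold isCanon
  rw [if_pos rfl, List.all_eq_true]
  intro σ _
  rw [decide_eq_true_eq, ← cellsList_bperm, bperm_bperm]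
  exact hπ (σ * π) (Finset.mem_univ _)

/-- Canonical representatives exist for every pattern (trivially for the non-generic ones). [this work] -/
theorem canon_rep {b : Fin 3 → Bool × Bool} {D : LocalDatum} (hv : D.Valid (patPre b)) :
    ∃ D' : LocalDatum, D'.Valid (patPre b) ∧ isCanon b (cellsList D') = true ∧ D'.FlocT = D.FlocT := by
  by_cases hb : b = bgen
  · subst hb
    obtain ⟨π, hπ⟩ := exists_canon D
    exact ⟨D.bperm π, valid_bperm hv π, hπ, FlocT_bperm D π⟩
  · refine ⟨D, hv, ?_, rfl⟩
    unfold isCanon; rw [if_neg hb]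

/-- **From a chunked check to the finite theorem**: if the check from a cell prefix of a CANONICAL valid datum passes, `F_loc(D) ≥ 0`.
[this work] -/
theorem flocT_nonneg_of_checkPatternFrom {b : Fin 3 → Bool × Bool} (D : LocalDatum) (hv : D.Valid (patPre b))
    (hcan : isCanon b (cellsList D) = true) (pre : List (Fin 3))
    (hpre : pre = (cellsList D).take pre.length) (hlen : pre.length ≤ 27) (hb : checkPatternFrom b pre = true) : 0 ≤ D.FlocT := by
  unfold checkPatternFrom at hb
  dsimp only at hb
  have hsplit : cellsList D = pre ++ (cellsList D).drop pre.length := by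
    conv_lhs => rw [← List.take_append_drop pre.length (cellsList D)]
    rw [← hpre]
  have hl : ((cellsList D).drop pre.length).length = 27 - pre.length := by simp [cellsList]
  have h1 := allSeq_spec (choicesCell (cmpTabs (leTab b))) _ (27 - pre.length) pre ((cellsList D).drop pre.length) hl
    (fun k hk => by
      have hk' : pre.length + k < (cellsList D).length := by simp [cellsList] at hk ⊢; omega
      have := cellsList_choices hv (pre.length + k) hk'
      have e1 : (cellsList D)[pre.length + k] = ((cellsList D).drop pre.length)[k] := by
        simp [List.getElem_drop]
      have e2 : (cellsList D).take (pre.length + k) = pre ++ ((cellsList D).drop pre.length).take k := by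
        conv_lhs => rw [hsplit]
        rw [List.take_length_add_append]
      rw [e1, e2] at this; exact this) hb
  rw [← hsplit] at h1
  simp only [hcan, ↓reduceIte, classify_eq] at h1
  have h2 := allSeq_spec (choicesRep (compPet (leTab b) (cellsList D).toArray) (cellsList D).toArray) _ 27 [] (repsList hv)
    (by simp [repsList]) (fun k hk => by simpa using repsList_choices hv k hk) h1
  simp only [List.nil_append, decide_eq_true_eq] at h2
  rw [← Xloc_eq_fast] at h2
  exact h2.trans (Xloc_le_FlocT hv)

/-- **Chunked form**: if, for some prefix length `L`, the check passes from every admissible cell prefix of length `L`, then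
`F_loc ≥ 0` for every valid datum of that pattern (the prefixes can be verified in separate files). [this work] -/
theorem flocT_nonneg_of_chunks {b : Fin 3 → Bool × Bool} (L : ℕ) (hL : L ≤ 27)
    (h : ∀ pre ∈ enumSeq (choicesCell (cmpTabs (leTab b))) L, checkPatternFrom b pre = true) (D : LocalDatum) (hv : D.Valid (patPre b)) :
    0 ≤ D.FlocT := by
  obtain ⟨D', hv', hcan, hF⟩ := canon_rep hv
  rw [← hF]
  have hlen : ((cellsList D').take L).length = L := by simp [cellsList]; omega
  have hmem : (cellsList D').take L ∈ enumSeq (choicesCell (cmpTabs (leTab b))) L := by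
    apply mem_enumSeq _ L _ hlen
    intro k hk
    rw [hlen] at hk
    have hk' : k < (cellsList D').length := by simp [cellsList]; omega
    have := cellsList_choices hv' k hk'
    rw [List.getElem_take, List.take_take, min_eq_left (le_of_lt hk)]
    exact this
  exact flocT_nonneg_of_checkPatternFrom D' hv' hcan ((cellsList D').take L) (by rw [hlen]) (by rw [hlen]; exact hL) (h _ hmem)

/-- **From the check to the finite theorem.** [this work] -/
theorem flocT_nonneg_of_checkPattern {b : Fin 3 → Bool × Bool} (hb : checkPattern b = true) (D : LocalDatum)
    (hv : D.Valid (patPre b)) : 0 ≤ D.FlocT :=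
  flocT_nonneg_of_chunks 0 (by omega) (fun pre hpre => by
    simp only [enumSeq, List.mem_singleton] at hpre; subst hpre; exact hb) D hv

/-- **From chunked checks of all 64 patterns to the three-block median certificate.** [this work] -/
theorem threeBlockMedianCertificate_of_chunked (L : (Fin 3 → Bool × Bool) → ℕ) (hL : ∀ b, L b ≤ 27)
    (h : ∀ b, ∀ pre ∈ enumSeq (choicesCell (cmpTabs (leTab b))) (L b), checkPatternFrom b pre = true) : ThreeBlockMedianCertificate :=
  threeBlockMedianCertificate_of_patterns fun b D hv => flocT_nonneg_of_chunks (L b) (hL b) (h b) D hv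

/-- Every comparison pattern is listed. [this work] -/
theorem mem_allPatterns (b : Fin 3 → Bool × Bool) : b ∈ allPatterns := by
  revert b; decide

/-- **From the complete check to the three-block median certificate.** [this work] -/
theorem threeBlockMedianCertificate_of_checkAll (h : checkAll = true) : ThreeBlockMedianCertificate := by
  apply threeBlockMedianCertificate_of_patterns
  intro b D hv
  unfold checkAll at h
  rw [List.all_eq_true] at h
  exact flocT_nonneg_of_checkPattern (h b (mem_allPatterns b)) D hv


end FiniteCheck

end ChainCert

end Summit.CriticalPhenomena.PercolationContinuityZ3.Theorems.SunflowerPartition
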